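import Summits.Langlands.Langlands.Theses.PicardMuOrdinary
import Literature.NumberTheory.Automorphic.ChebotarevArtinRepHolds
import Literature.NumberTheory.PAdicHodge.FontaineDpst
import Literature.NumberTheory.GaloisRepresentations.PstWeilDeligne
import Literature.NumberTheory.GaloisRepresentations.PstWeilDeligneModelIndependence
import Literature.NumberTheory.GaloisRepresentations.FrobeniusDensity
import Literature.NumberTheory.GaloisRepresentations.PatchingLemma
import Literature.NumberTheory.GaloisRepresentations.ContinuousRep
import HarnessLib

/-!
# Route `PicardMuOrdinary`, crux `IrregularClassicality` (stmt-Langlands-13758), line `slope-free-polarized-limit`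
# (skeleton r10): Stub I — trace identification

`K = ℚ(ω) = CyclotomicField 3 ℚ`, `ℓ = 3`.  Two absolutely irreducible continuous framed representations
`ρ, ρ' : Γ_K →ₜ* GL₃(ℚ̄₃)` with the same traces at all geometric Frobenii `τ⁻¹` (`τ` an arithmetic Frobenius at a
prime `𝔓` of `ℤ̄_K` over a place `𝔭 ∉ S`, `S` finite) are conjugate, so de Rham-ness at the places `v ∣ 3` (for
Fontaine's pinned datum `PAdicHodge.fontainePstAdicCompletion v 3 hv`) passes from `ρ'` to `ρ`
(`stub_traceIdentification`).  Proof: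

1. Chebotarev (`absoluteGaloisGroup.frobenius_dense`, fed with the proved `chebotarev_artinRep_holds`): the arithmetic
   Frobenii off `S` are dense in `Γ_K`, hence so are their inverses (inversion is a homeomorphism); the traces
   `g ↦ tr ρ(g)` are continuous (`FramedRep.continuous_trace`) and `ℚ̄₃` is Hausdorff, so `tr ρ = tr ρ'` on `Γ_K`.
2. Brauer–Nesbitt in characteristic `0` (`SorensenPatching.exists_conj_of_trace_eq`; absolutely irreducible ⇒
   irreducible ⇒ semisimple): `ρ' = P ρ P⁻¹`, i.e. `ρ = FramedRep.conj P⁻¹ ρ'`.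
3. Restriction to a decomposition group commutes with change of frame (`rfl`), and `IsDeRhamFramed` is invariant
   under change of frame (a `ℚ_ℓ`-model of `ρ'` is one of `Q ρ' Q⁻¹`: `HasQlModel` composes with `conj`).

References: J.-P. Serre, *Abelian ℓ-adic representations and elliptic curves* (1968), Ch. I §2.3;
C. W. Curtis, I. Reiner, *Methods of Representation Theory* I (1981), (30.14) (Brauer–Nesbitt / trace determines a
semisimple representation in characteristic `0`); J.-M. Fontaine, Astérisque 223 (1994), Exp. III §1.5.
-/

open Literature.NumberTheory.GaloisRepresentations Literature.NumberTheory.Automorphic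
open Literature.NumberTheory
open scoped NumberField
open IsDedekindDomain NumberField Polynomial Field

-- `Summit.Langlands.Langlands.…` (summit = sub-problem name, D-0017 layout) trips `dupNamespace` on every decl.
set_option linter.dupNamespace false
set_option autoImplicit false

namespace Summit.Langlands.Langlands.Theorems.IrregularClassicality.SlopeFreePolarizedLimit

noncomputable section

/-! ### Change of frame -/

/-- Iterated change of frame: `conj Q (conj P ρ) = conj (Q * P) ρ`. [folklore] -/
theorem conj_conj_eq_conj_mul {G : Type*} [Group G] [TopologicalSpace G] {k : Type*} [Field k]
    [TopologicalSpace k] [IsTopologicalRing k] {n : ℕ} (P Q : GL (Fin n) k) (ρ : FramedRep G k n) :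
    FramedRep.conj Q (FramedRep.conj P ρ) = FramedRep.conj (Q * P) ρ := by
  ext g : 1
  simp only [FramedRep.conj_apply, _root_.mul_inv_rev]
  group

/-- Undoing a change of frame: if `ρ' x = P ρ x P⁻¹` for all `x` then `ρ = conj P⁻¹ ρ'`. [folklore] -/
theorem eq_conj_inv_of_forall_eq {G : Type*} [Group G] [TopologicalSpace G] {k : Type*} [Field k]
    [TopologicalSpace k] [IsTopologicalRing k] {n : ℕ} (P : GL (Fin n) k) {ρ ρ' : FramedRep G k n}
    (h : ∀ x, ρ' x = P * ρ x * P⁻¹) : ρ = FramedRep.conj P⁻¹ ρ' := by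
  ext g : 1
  rw [FramedRep.conj_apply, h g]
  group

/-- **De Rham-ness does not see the frame**: `𝔇.IsDeRhamFramed ρ → 𝔇.IsDeRhamFramed (P ρ P⁻¹)`
(a `ℚ_ℓ`-model of `ρ` is one of `P ρ P⁻¹`, `HasQlModel` composing with `conj`). [folklore] -/
theorem isDeRhamFramed_conj {F : Type} [Field F] [ValuativeRel F] [TopologicalSpace F]
    [IsNonarchimedeanLocalField F] {ℓ : ℕ} [Fact ℓ.Prime] (𝔇 : PstWeilDeligneData F ℓ) {n : ℕ}
    (P : GL (Fin n) (PadicAlgCl ℓ)) {ρ : FramedRep (absoluteGaloisGroup F) (PadicAlgCl ℓ) n}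
    (h : 𝔇.IsDeRhamFramed ρ) : 𝔇.IsDeRhamFramed (FramedRep.conj P ρ) := by
  obtain ⟨E, hE, rE, ⟨P₀, hP₀⟩, hdR⟩ := h
  exact ⟨E, hE, rE, ⟨P * P₀, by rw [← conj_conj_eq_conj_mul, hP₀]⟩, hdR⟩

/-- Restriction to a decomposition group commutes with change of frame. [folklore] -/
theorem toLocal_conj {K : Type} [Field K] [NumberField K] {ℓ : ℕ} [Fact ℓ.Prime] {n : ℕ}
    (v : HeightOneSpectrum (𝓞 K)) (P : GL (Fin n) (PadicAlgCl ℓ)) (ρ : FramedGaloisRep K (PadicAlgCl ℓ) n) :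
    FramedGaloisRep.toLocal v (FramedRep.conj P ρ) = FramedRep.conj P (ρ.toLocal v) := rfl

/-! ### Equality of traces on `Γ_K` from equality at the geometric Frobenii off a finite set -/

/-- **Chebotarev + continuity.**  For a number field `K`, a finite set `S` of finite places and two framed
`ρ, ρ' : Γ_K →ₜ* GL_n(ℚ̄_ℓ)` whose traces agree at every geometric Frobenius `τ⁻¹` (`τ` an arithmetic Frobenius
at some prime of `ℤ̄_K` over some `𝔭 ∉ S`), the traces agree on all of `Γ_K`: the arithmetic Frobenii off `S` are
dense (`absoluteGaloisGroup.frobenius_dense`, `chebotarev_artinRep_holds`), inversion is a homeomorphism, and the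
traces are continuous into the Hausdorff `ℚ̄_ℓ`. [folklore] -/
theorem trace_eq_of_frobTrace_eq {K : Type} [Field K] [NumberField K] {ℓ : ℕ} [Fact ℓ.Prime] {n : ℕ}
    (S : Finset (HeightOneSpectrum (𝓞 K))) (ρ ρ' : FramedGaloisRep K (PadicAlgCl ℓ) n)
    (htr : ∀ 𝔭 ∉ S, ∀ 𝔓 ∈ 𝔭.primesAbove, ∀ τ : absoluteGaloisGroup K, IsArithFrobAt (𝓞 K) τ 𝔓 →
      FramedRep.trace ρ τ⁻¹ = FramedRep.trace ρ' τ⁻¹) (g : absoluteGaloisGroup K) :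
    FramedRep.trace ρ g = FramedRep.trace ρ' g := by
  -- the inverses of the arithmetic Frobenii off `S` are dense
  have hD : Dense {g : absoluteGaloisGroup K |
      ∃ v ∉ (S : Set (HeightOneSpectrum (𝓞 K))), ∃ 𝔓 ∈ v.primesAbove, IsArithFrobAt (𝓞 K) g⁻¹ 𝔓} := by
    have h := absoluteGaloisGroup.frobenius_dense chebotarev_artinRep_holds K
      (S : Set (HeightOneSpectrum (𝓞 K))) S.finite_toSet
    exact h.preimage (Homeomorph.inv (absoluteGaloisGroup K)).isOpenMap
  -- the traces agree there
  have hsub : {g : absoluteGaloisGroup K |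
      ∃ v ∉ (S : Set (HeightOneSpectrum (𝓞 K))), ∃ 𝔓 ∈ v.primesAbove, IsArithFrobAt (𝓞 K) g⁻¹ 𝔓} ⊆
      {g | FramedRep.trace ρ g = FramedRep.trace ρ' g} := by
    rintro g ⟨v, hv, 𝔓, h𝔓, hg⟩
    have h := htr v (fun h => hv (Finset.mem_coe.2 h)) 𝔓 h𝔓 g⁻¹ hg
    rwa [inv_inv] at h
  -- and the coincidence set is closed
  have hclosed : IsClosed {g : absoluteGaloisGroup K | FramedRep.trace ρ g = FramedRep.trace ρ' g} :=
    isClosed_eq (FramedRep.continuous_trace ρ) (FramedRep.continuous_trace ρ')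
  exact hclosed.closure_subset_iff.2 hsub (hD g)

/-- **Brauer–Nesbitt for absolutely irreducible framed representations with equal Frobenius traces.**  Two
absolutely irreducible `ρ, ρ' : Γ_K →ₜ* GL_n(ℚ̄_ℓ)` with the same geometric-Frobenius traces off a finite `S` are
conjugate: `ρ' = P ρ P⁻¹` (`trace_eq_of_frobTrace_eq`, then `SorensenPatching.exists_conj_of_trace_eq`, the
underlying representations being irreducible, hence semisimple). [folklore] -/
theorem exists_conj_of_frobTrace_eq {K : Type} [Field K] [NumberField K] {ℓ : ℕ} [Fact ℓ.Prime] {n : ℕ}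
    (S : Finset (HeightOneSpectrum (𝓞 K))) (ρ ρ' : FramedGaloisRep K (PadicAlgCl ℓ) n)
    (hρ : FramedRep.IsAbsolutelyIrreducible ρ) (hρ' : FramedRep.IsAbsolutelyIrreducible ρ')
    (htr : ∀ 𝔭 ∉ S, ∀ 𝔓 ∈ 𝔭.primesAbove, ∀ τ : absoluteGaloisGroup K, IsArithFrobAt (𝓞 K) τ 𝔓 →
      FramedRep.trace ρ τ⁻¹ = FramedRep.trace ρ' τ⁻¹) :
    ∃ P : GL (Fin n) (PadicAlgCl ℓ), ∀ x, ρ' x = P * ρ x * P⁻¹ := by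
  have hss : ρ.toRepresentation.IsSemisimpleRepresentation := by
    haveI : ρ.toRepresentation.IsIrreducible := hρ.isIrreducible
    infer_instance
  have hss' : ρ'.toRepresentation.IsSemisimpleRepresentation := by
    haveI : ρ'.toRepresentation.IsIrreducible := hρ'.isIrreducible
    infer_instance
  exact SorensenPatching.exists_conj_of_trace_eq ρ ρ' hss hss' (trace_eq_of_frobTrace_eq S ρ ρ' htr)

/-! ### Stub I -/

/-- **Stub I — trace identification** (line `slope-free-polarized-limit`, skeleton r10, crux
`PicardMuOrdinary.IrregularClassicality`).  For `K = ℚ(ω)`, `ℓ = 3`: if `ρ, ρ' : Γ_K →ₜ* GL₃(ℚ̄₃)` are absolutely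
irreducible with equal traces at all geometric Frobenii off a finite `S`, and `ρ'` is de Rham at every `v ∣ 3` for
Fontaine's pinned datum `PAdicHodge.fontainePstAdicCompletion v 3 hv`, then so is `ρ`: by Chebotarev + continuity +
Brauer–Nesbitt `ρ = P⁻¹ ρ' P` (`exists_conj_of_frobTrace_eq`), restriction to `Γ_{K_v}` commutes with the change of
frame, and `IsDeRhamFramed` is frame-invariant (`isDeRhamFramed_conj`). [folklore] -/
theorem stub_traceIdentification :
∀ (S : Finset (HeightOneSpectrum (𝓞 (CyclotomicField 3 ℚ)))) (ρ ρ' : FramedGaloisRep (CyclotomicField 3 ℚ) (PadicAlgCl 3) 3),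
    FramedRep.IsAbsolutelyIrreducible ρ → FramedRep.IsAbsolutelyIrreducible ρ' →
    (∀ 𝔭 ∉ S, ∀ 𝔓 ∈ 𝔭.primesAbove, ∀ τ : absoluteGaloisGroup (CyclotomicField 3 ℚ), IsArithFrobAt (𝓞 (CyclotomicField 3 ℚ)) τ 𝔓 →
      FramedRep.trace ρ τ⁻¹ = FramedRep.trace ρ' τ⁻¹) →
    (∀ (v : HeightOneSpectrum (𝓞 (CyclotomicField 3 ℚ))) (hv : ((3 : ℕ) : 𝓞 (CyclotomicField 3 ℚ)) ∈ v.asIdeal),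
      (PAdicHodge.fontainePstAdicCompletion v 3 hv).IsDeRhamFramed (ρ'.toLocal v)) →
    ∀ (v : HeightOneSpectrum (𝓞 (CyclotomicField 3 ℚ))) (hv : ((3 : ℕ) : 𝓞 (CyclotomicField 3 ℚ)) ∈ v.asIdeal),
      (PAdicHodge.fontainePstAdicCompletion v 3 hv).IsDeRhamFramed (ρ.toLocal v) := by
  intro S ρ ρ' hρ hρ' htr hdR' v hv
  obtain ⟨P, hP⟩ := exists_conj_of_frobTrace_eq S ρ ρ' hρ hρ' htr
  rw [eq_conj_inv_of_forall_eq P hP, toLocal_conj]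
  exact isDeRhamFramed_conj _ P⁻¹ (hdR' v hv)

end

end Summit.Langlands.Langlands.Theorems.IrregularClassicality.SlopeFreePolarizedLimit
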